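import Summits.AtomisticToContinuum.FouriersLaw.Theorems.BondHeatUncertaintyExtensiveSnapshotIrreversibilityEnergyWindowOddMomentChain
import Summits.AtomisticToContinuum.FouriersLaw.Theorems.BondHeatUncertaintyExtensiveSnapshotIrreversibilityEnergyWindowDivergenceFilter

/-!
# Crux `ExtensiveSnapshotIrreversibility` (stmt-AtomisticToContinuum-9121), fixed-`N` half `K_fix`:
the DIVERGENCE LADDER — the two NESS atoms, the junction, and the necessity
(node «DivergenceLadder», 3/6)

(statement + glue file, theorem-side; decomp-a2c lens-1 «grading / quantitative ladder», gen 89.)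

The window junction of record (`snapshotKLUpperExpansion_of_atoms_moment₅K`, gen 88:
`K_fix ⟸ A0 ∧ A2ₚ ∧ S3 ∧ A3p ∧ A4`) controls the second-order term through an `L²(μ_T)` LINEAR
RESPONSE (A4) and the tails through a one-sided DENSITY FLOOR on an energy window (A3 ⟸ S3 ∧ A3p).
This file records the OR-sibling obtained by GRADING THE DIVERGENCE instead of the window: the
second-order content is carried by the weakest classical object — the TRIANGULAR DISCRIMINATION
`Δ(μ_δ, Θ_*μ_δ) = ∫ (f − f̃)²/(f + f̃) dμ_T` (`f = dμ_δ/dμ_T`, `f̃ = f∘Θ`), a bounded `f`-divergence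
(`Δ ≤ 2`, Le Cam / Vincze), equivalent up to the factor 2 to the squared Hellinger distance — and
the
tails by CONCENTRATION IN PROBABILITY of the odd log-ratio.  Two closed Props about the NESS family:

* ΔSharp `NessFlipTriangularSharp` — for the item's response density `h` and every
  `K > ½ ∫ (h − h∘Θ)² dμ_{N,T,T}`: eventually `Δ(μ_δ, Θ_*μ_δ) ≤ K δ²` (the SHARP constant; PROVED
  NECESSARY for `K_fix` below, and strictly below A4 — see `…EnergyWindowDivergenceRungs`);
* SPC `NessOddLogRatioConcentration` — for every level `η > 0` and every order `s`:
  `μ_δ(|ψ_δ| > η) ≤ |δ|ˢ` for `0 < |δ| < δ₀(η, s)` (superpolynomial concentration of the odd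
  log-ratio `ψ_δ = log dμ_δ/dΘ_*μ_δ` under the steady state; NO pointwise or moment growth bound).

Results:
* ★ `snapshotKLUpperExpansion_of_triangular` — **`K_fix ⟸ A0 ∧ A2ₚ ∧ SPC ∧ ΔSharp`** for every
  `p > 1` (the abstract seam `klDiv_flip_le_of_triangular`; the item's `h` passes through untouched
  —
  no identification of the response density is needed, the thresholds coincide verbatim);
  `snapshotKLUpperExpansion_of_triangular₂` the `p = 2` instance;
* ★ `nessFlipTriangularSharp_of_snapshotKLUpperExpansion` — **NECESSITY `K_fix ⟹ ΔSharp`**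
  (pointwise `t ≤ k`: `integral_triangular_le_toReal_klDiv`), so that
  `A2ₚ ∧ SPC ⊢ (K_fix ⟺ ΔSharp)`: modulo the tail atoms the crux IS the sharp second-order bound in
  the bounded divergence.

Positioning.  Versus the window line (70W–88M): no energy window, no floor (A3/S3/A3p), no
`L²(μ_T)` difference quotient (A4 ⟹ ΔSharp strictly, `…DivergenceRungs`); shares A0 and A2ₚ.
Versus the tree's hellinger–logmean line (`Cruxes/ExtensiveSnapshotIrreversibility/Lines/
hellinger-logmean`: S_H1 two-sided sandwich `|ψ| ≤ 2η(1+H)` eventually ∧ S_H2 weighted Hellinger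
differentiability): SPC is an in-probability statement with a rate where S_H1 is an almost-sure
envelope, and ΔSharp is unweighted where S_H2 carries the `cosh`-weight; the price is the moment
atom
A2ₚ (some moment input is necessary for `KL < ∞` at all, `Negative.klDiv_flip_tilted_ne_top_iff`).

No new objects. [folklore]
-/

noncomputable section

namespace Summit.AtomisticToContinuum.FouriersLaw.Theorems.ExtensiveSnapshotIrreversibility.EnergyWindow

open MeasureTheory Filter Topology InformationTheory Real
open scoped ENNReal NNReal
open Literature.MathematicalPhysics.KineticTheory.HeatConduction
open Summit.AtomisticToContinuum.FouriersLaw.Theorems.ExtensiveSnapshotIrreversibility.Negative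
open Summit.AtomisticToContinuum.FouriersLaw.Theorems.ExtensiveSnapshotIrreversibility.ClausiusBudget.OddLogDensity

variable {N : ℕ}

/-! ## 1. The two atoms -/

/-- **ΔSharp `NessFlipTriangularSharp` (sharp second-order snapshot irreversibility in triangular
discrimination)**: along every steady-state family of the pinned chain (under weak-NESS uniqueness),
for `T > 0`, `N ≥ 2`, every `L²` linear-response density `h` at `δ = 0` (VERBATIM the hypothesis of
`K_fix`) and every `K > ½ ∫ (h − h∘Θ)² dμ_{N,T,T}`: eventually in `δ ≠ 0`, for EVERY measurable `φ`
with `μ_{N,T+δ/2,T−δ/2} = μ_T · e^{φ}`,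
`∫ (e^{φ} − e^{φ∘Θ})²/(e^{φ} + e^{φ∘Θ}) dμ_T ≤ K δ²` — i.e. `Δ(μ_δ, Θ_*μ_δ) ≤ K δ²`
(an intrinsic `f`-divergence of the pair `(μ_δ, Θ_*μ_δ)`; bounded by `2`; necessary for `K_fix`,
`nessFlipTriangularSharp_of_snapshotKLUpperExpansion`).
[route statement · this cell; NOT a literature fact] -/
def NessFlipTriangularSharp : Prop :=
  ∀ ω₂ lam β γ : ℝ, 0 < ω₂ → 0 < lam → 0 < β → 0 < γ →
    (∀ (N : ℕ) (T_L T_R : ℝ), 0 < T_L → 0 < T_R → ∀ μ ν : Measure (PhaseSpace N),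
      (pinnedChain ω₂ lam β γ).IsSteadyState N T_L T_R μ →
      (pinnedChain ω₂ lam β γ).IsSteadyState N T_L T_R ν → μ = ν) →
    ∀ μ : (N : ℕ) → ℝ → ℝ → Measure (PhaseSpace N),
      (∀ (N : ℕ) (T_L T_R : ℝ), 0 < T_L → 0 < T_R →
        (pinnedChain ω₂ lam β γ).IsSteadyState N T_L T_R (μ N T_L T_R)) →
      ∀ T : ℝ, 0 < T → ∀ N : ℕ, 2 ≤ N → ∀ h : PhaseSpace N → ℝ,
        (MemLp h 2 (μ N T T) ∧
          (∀ F : PhaseSpace N → ℝ, ContDiff ℝ ((⊤ : ℕ∞) : WithTop ℕ∞) F → HasCompactSupport F →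
            Tendsto (fun δ : ℝ => ((∫ x, F x ∂(μ N (T + δ / 2) (T - δ / 2))) -
              ∫ x, F x ∂(μ N T T)) / δ)
              (𝓝[≠] (0 : ℝ)) (𝓝 (∫ x, F x * h x ∂(μ N T T)))) ∧
          (∀ i : Fin N, Tendsto (fun δ : ℝ =>
              ((∫ x, (pinnedChain ω₂ lam β γ).bondCurrent N i x ∂(μ N (T + δ / 2) (T - δ / 2))) -
                ∫ x, (pinnedChain ω₂ lam β γ).bondCurrent N i x ∂(μ N T T)) / δ)
              (𝓝[≠] (0 : ℝ))
              (𝓝 (∫ x, (pinnedChain ω₂ lam β γ).bondCurrent N i x * h x ∂(μ N T T))))) →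
        ∀ K : ℝ, (1 / 2 : ℝ) * ∫ x, (h x - h (x.1, -x.2)) ^ 2 ∂(μ N T T) < K →
          ∀ᶠ δ in 𝓝[≠] (0 : ℝ),
            ∀ φ : PhaseSpace N → ℝ, Measurable φ →
              μ N (T + δ / 2) (T - δ / 2) =
                ((pinnedChain ω₂ lam β γ).gibbsMeasure N T).withDensity
                  (fun x => ENNReal.ofReal (Real.exp (φ x))) →
              ∫ x, (Real.exp (φ x) - Real.exp (φ (x.1, -x.2))) ^ 2 /
                  (Real.exp (φ x) + Real.exp (φ (x.1, -x.2)))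
                ∂(pinnedChain ω₂ lam β γ).gibbsMeasure N T ≤ K * δ ^ 2

/-- **SPC `NessOddLogRatioConcentration` (superpolynomial concentration of the odd log-ratio)**:
along every steady-state family of the pinned chain (under weak-NESS uniqueness), for `T > 0`,
`N ≥ 2`, every level `η > 0` and every order `s`, there is `δ₀ > 0` such that for `0 < |δ| < δ₀` and
EVERY measurable `φ` with `μ_{N,T+δ/2,T−δ/2} = μ_T · e^{φ}`: the steady state gives the level set
`{|φ − φ∘Θ| > η}` mass at most `|δ|ˢ` (`ψ_δ = φ − φ∘Θ = log dμ_δ/dΘ_*μ_δ` is intrinsic; an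
in-probability statement — no pointwise envelope, no window, no moment; `KL ≤ Kδ²` alone gives it
only at orders `s ≤ 1`). [route statement · this cell; NOT a literature fact] -/
def NessOddLogRatioConcentration : Prop :=
  ∀ ω₂ lam β γ : ℝ, 0 < ω₂ → 0 < lam → 0 < β → 0 < γ →
    (∀ (N : ℕ) (T_L T_R : ℝ), 0 < T_L → 0 < T_R → ∀ μ ν : Measure (PhaseSpace N),
      (pinnedChain ω₂ lam β γ).IsSteadyState N T_L T_R μ →
      (pinnedChain ω₂ lam β γ).IsSteadyState N T_L T_R ν → μ = ν) →
    ∀ μ : (N : ℕ) → ℝ → ℝ → Measure (PhaseSpace N),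
      (∀ (N : ℕ) (T_L T_R : ℝ), 0 < T_L → 0 < T_R →
        (pinnedChain ω₂ lam β γ).IsSteadyState N T_L T_R (μ N T_L T_R)) →
      ∀ T : ℝ, 0 < T → ∀ N : ℕ, 2 ≤ N → ∀ η : ℝ, 0 < η → ∀ s : ℝ,
        ∃ δ₀ : ℝ, 0 < δ₀ ∧
          ∀ δ : ℝ, δ ≠ 0 → |δ| < δ₀ →
            ∀ φ : PhaseSpace N → ℝ, Measurable φ →
              μ N (T + δ / 2) (T - δ / 2) =
                ((pinnedChain ω₂ lam β γ).gibbsMeasure N T).withDensity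
                  (fun x => ENNReal.ofReal (Real.exp (φ x))) →
              (μ N (T + δ / 2) (T - δ / 2)) {x | η < |φ x - φ (x.1, -x.2)|} ≤
                ENNReal.ofReal (|δ| ^ s)

/-! ## 2. The junction `K_fix ⟸ A0 ∧ A2ₚ ∧ SPC ∧ ΔSharp` -/

/-- The mass of a measurable set under a normalised tilt, as a `μ₀`-integral:
`∫_A e^{φ} dμ₀ = (μ₀ · e^{φ})(A)`. [folklore] -/
theorem setIntegral_exp_eq_toReal_tilted (μ₀ : Measure (PhaseSpace N)) {φ : PhaseSpace N → ℝ}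
    (hexp : Integrable (fun x => exp (φ x)) μ₀) (hZ1 : ∫ x, exp (φ x) ∂μ₀ = 1)
    {A : Set (PhaseSpace N)} (hA : MeasurableSet A) :
    ∫ x in A, exp (φ x) ∂μ₀ = ((μ₀.tilted φ) A).toReal := by
  rw [tilted_apply' _ _ hA, integral_eq_lintegral_of_nonneg_ae (ae_of_all _ fun x => (exp_pos _).le)
    hexp.aestronglyMeasurable.restrict]
  simp only [hZ1, div_one]

/-- ★ **THE JUNCTION `K_fix ⟸ A0 ∧ A2ₚ ∧ SPC ∧ ΔSharp` (`p > 1`).**  Take the A0 exponents `φ_δ`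
(`|δ| < 2T`); `μ_T` is a flip-invariant probability measure (`Negative.gibbsMeasure_map_flip`), the
states are `μ_T.tilted φ_δ` (`tilted_of_withDensity_exp`), so A2ₚ is the moment clause (T2ₚ) of the
seam `klDiv_flip_le_of_triangular`, SPC its concentration clause (the level-set mass as
`∫_{A} e^{φ_δ} dμ_T`, `setIntegral_exp_eq_toReal_tilted`) and ΔSharp — at the item's own `h` — its
second-order clause with `D = ½ ∫ (h − h∘Θ)² dμ_{N,T,T}`; the thresholds coincide verbatim.
[folklore] -/
theorem snapshotKLUpperExpansion_of_triangular {p : ℝ} (hp : 1 < p) (h0 : NessGibbsReweighting)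
    (h2 : NessOddLogRatioMoment p) (hc : NessOddLogRatioConcentration)
    (hΔ : NessFlipTriangularSharp) : SnapshotKLUpperExpansion := by
  intro ω₂ lam β γ hω₂ hlam hβ hγ hU μ hμ T hT N hN h hh K hK
  obtain ⟨φ, hφm, hW0⟩ := h0 ω₂ lam β γ hω₂ hlam hβ hγ hU μ hμ T hT N hN
  obtain ⟨δ₂, C₂, r, hδ₂, hT2⟩ := h2 ω₂ lam β γ hω₂ hlam hβ hγ hU μ hμ T hT N hN
  have hcT := hc ω₂ lam β γ hω₂ hlam hβ hγ hU μ hμ T hT N hN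
  have hΔh := hΔ ω₂ lam β γ hω₂ hlam hβ hγ hU μ hμ T hT N hN h hh
  set P := pinnedChain ω₂ lam β γ with hP
  set μT := P.gibbsMeasure N T with hμT
  haveI hprob : IsProbabilityMeasure μT :=
    pinnedChain_isProbabilityMeasure_gibbsMeasure hω₂ hlam.le hβ.le γ N hT
  have hinv : μT.map (fun x : PhaseSpace N => (x.1, -x.2)) = μT := gibbsMeasure_map_flip P N T
  have hpq : p.HolderConjugate (conjExponent p) := Real.HolderConjugate.conjExponent hp
  -- the eventual range and the tilted representation of the states
  have h2T : (0 : ℝ) < 2 * T := by positivity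
  set δ₀ : ℝ := min δ₂ (2 * T) with hδ₀def
  have hδ₀ : 0 < δ₀ := lt_min hδ₂ h2T
  have hδ₀₂ : δ₀ ≤ δ₂ := min_le_left _ _
  have hδ₀T : δ₀ ≤ 2 * T := min_le_right _ _
  have hev : ∀ᶠ δ in 𝓝[≠] (0 : ℝ), δ ≠ 0 ∧ |δ| < δ₀ := eventually_ne_and_abs_lt hδ₀
  have hevT : ∀ᶠ δ in 𝓝[≠] (0 : ℝ), 0 < T + δ / 2 ∧ 0 < T - δ / 2 := eventually_bath_temps_pos hT
  have hrep : ∀ δ : ℝ, |δ| < δ₀ → 0 < T + δ / 2 → 0 < T - δ / 2 →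
      Integrable (fun x => exp (φ δ x)) μT ∧ ∫ x, exp (φ δ x) ∂μT = 1 ∧
        μ N (T + δ / 2) (T - δ / 2) = μT.tilted (φ δ) := by
    intro δ hδa h1' h2'
    haveI : IsProbabilityMeasure (μ N (T + δ / 2) (T - δ / 2)) := (hμ N _ _ h1' h2').1
    exact tilted_of_withDensity_exp (hφm δ) (hW0 δ (hδa.trans_le hδ₀T))
  have hZ : ∀ᶠ δ in 𝓝[≠] (0 : ℝ),
      Integrable (fun x => exp (φ δ x)) μT ∧ ∫ x, exp (φ δ x) ∂μT = 1 := by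
    filter_upwards [hev, hevT] with δ hδ hδT
    exact ⟨(hrep δ hδ.2 hδT.1 hδT.2).1, (hrep δ hδ.2 hδT.1 hδT.2).2.1⟩
  -- (T2ₚ) from A2ₚ
  have hT2' : ∀ᶠ δ in 𝓝[≠] (0 : ℝ),
      Integrable (fun x => |φ δ x - φ δ (x.1, -x.2)| ^ p * exp (φ δ x)) μT ∧
        ∫ x, |φ δ x - φ δ (x.1, -x.2)| ^ p * exp (φ δ x) ∂μT ≤ C₂ * |δ| ^ (-r) := by
    filter_upwards [hev, hevT] with δ hδ hδT
    obtain ⟨hi, hz1, htilt⟩ := hrep δ hδ.2 hδT.1 hδT.2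
    obtain ⟨hI, hle⟩ := hT2 δ hδ.1 (hδ.2.trans_le hδ₀₂) (φ δ) (hφm δ) (hW0 δ (hδ.2.trans_le hδ₀T))
    rw [htilt] at hI hle
    rw [integrable_tilted_iff hi] at hI
    rw [integral_tilted] at hle
    refine ⟨hI.congr (ae_of_all _ fun x => ?_), ?_⟩
    · simp only [smul_eq_mul]
      ring
    · refine le_trans (le_of_eq (integral_congr_ae (ae_of_all _ fun x => ?_))) hle
      simp only [hz1, div_one, smul_eq_mul]
      ring
  -- (SPC) in the seam's form: the level-set mass as a `μ_T`-integral of `e^{φ_δ}`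
  have hSPC' : ∀ η : ℝ, 0 < η → ∀ s : ℝ, ∀ᶠ δ in 𝓝[≠] (0 : ℝ),
      ∫ x in {x | η < |φ δ x - φ δ (x.1, -x.2)|}, exp (φ δ x) ∂μT ≤ |δ| ^ s := by
    intro η hη s
    obtain ⟨δc, hδc, hcδ⟩ := hcT η hη s
    filter_upwards [eventually_ne_and_abs_lt (lt_min hδc hδ₀), hevT] with δ hδ hδT
    have hδ' : |δ| < δ₀ := hδ.2.trans_le (min_le_right _ _)
    obtain ⟨hi, hz1, htilt⟩ := hrep δ hδ' hδT.1 hδT.2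
    have hmass := hcδ δ hδ.1 (hδ.2.trans_le (min_le_left _ _)) (φ δ) (hφm δ)
      (hW0 δ (hδ'.trans_le hδ₀T))
    rw [htilt] at hmass
    have hA : MeasurableSet {x : PhaseSpace N | η < |φ δ x - φ δ (x.1, -x.2)|} :=
      measurableSet_lt measurable_const (((hφm δ).sub ((hφm δ).comp measurable_flip)).abs)
    rw [setIntegral_exp_eq_toReal_tilted μT hi hz1 hA]
    have h' := ENNReal.toReal_mono ENNReal.ofReal_ne_top hmass
    rwa [ENNReal.toReal_ofReal (Real.rpow_nonneg (abs_nonneg δ) s)] at h'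
  -- (ΔSharp) in the seam's form, at the item's own `h`
  set D : ℝ := (1 / 2 : ℝ) * ∫ x, (h x - h (x.1, -x.2)) ^ 2 ∂(μ N T T) with hD
  have hΔ' : ∀ D' : ℝ, D < D' → ∀ᶠ δ in 𝓝[≠] (0 : ℝ),
      ∫ x, (exp (φ δ x) - exp (φ δ (x.1, -x.2))) ^ 2 / (exp (φ δ x) + exp (φ δ (x.1, -x.2))) ∂μT ≤
        D' * δ ^ 2 := by
    intro D' hD'
    filter_upwards [hΔh D' hD', hev] with δ hδΔ hδ
    exact hδΔ (φ δ) (hφm δ) (hW0 δ (hδ.2.trans_le hδ₀T))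
  have hseam := klDiv_flip_le_of_triangular μT hinv hpq φ hφm hZ hT2' hSPC' hΔ'
  filter_upwards [hseam K hK, hev, hevT] with δ hs hδ hδT
  rw [(hrep δ hδ.2 hδT.1 hδT.2).2.2]
  exact hs

/-- **`K_fix ⟸ A0 ∧ A2₂ ∧ SPC ∧ ΔSharp`** — the `p = 2` case (the new A2-slot of record,
critic row 1265). [folklore] -/
theorem snapshotKLUpperExpansion_of_triangular₂ (h0 : NessGibbsReweighting)
    (h2 : NessOddLogRatioMoment 2) (hc : NessOddLogRatioConcentration)
    (hΔ : NessFlipTriangularSharp) : SnapshotKLUpperExpansion :=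
  snapshotKLUpperExpansion_of_triangular one_lt_two h0 h2 hc hΔ

/-! ## 3. Necessity `K_fix ⟹ ΔSharp` -/

/-- ★ **NECESSITY `K_fix ⟹ ΔSharp`.**  Given a representation `μ_δ = μ_T · e^{φ}` at a `δ` where
`K_fix` gives `KL(μ_δ ‖ Θ_*μ_δ) ≤ K δ² < ∞`, the state is the normalised tilt `μ_T.tilted φ`
(`tilted_of_withDensity_exp`) and `Δ ≤ KL` (`integral_triangular_le_toReal_klDiv`: pointwise
`(f − f̃)²/(f + f̃) ≤ ½ (f − f̃) log(f/f̃)`).  No atom is used. [folklore] -/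
theorem nessFlipTriangularSharp_of_snapshotKLUpperExpansion (hK : SnapshotKLUpperExpansion) :
    NessFlipTriangularSharp := by
  intro ω₂ lam β γ hω₂ hlam hβ hγ hU μ hμ T hT N hN h hh K hKD
  have hev := hK ω₂ lam β γ hω₂ hlam hβ hγ hU μ hμ T hT N hN h hh K hKD
  set P := pinnedChain ω₂ lam β γ with hP
  set μT := P.gibbsMeasure N T with hμT
  haveI hprob : IsProbabilityMeasure μT :=
    pinnedChain_isProbabilityMeasure_gibbsMeasure hω₂ hlam.le hβ.le γ N hT
  have hinv : μT.map (fun x : PhaseSpace N => (x.1, -x.2)) = μT := gibbsMeasure_map_flip P N T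
  have hK0 : 0 ≤ K := by
    have : 0 ≤ (1 / 2 : ℝ) * ∫ x, (h x - h (x.1, -x.2)) ^ 2 ∂(μ N T T) :=
      mul_nonneg (by norm_num) (integral_nonneg fun x => sq_nonneg _)
    linarith
  filter_upwards [hev, eventually_bath_temps_pos hT] with δ hδ hδT φ hφm hrepφ
  haveI : IsProbabilityMeasure (μ N (T + δ / 2) (T - δ / 2)) := (hμ N _ _ hδT.1 hδT.2).1
  obtain ⟨hi, hz1, htilt⟩ := tilted_of_withDensity_exp hφm hrepφ
  rw [htilt] at hδ
  have hfin : klDiv (μT.tilted φ) ((μT.tilted φ).map (fun x : PhaseSpace N => (x.1, -x.2))) ≠ ∞ :=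
    ne_top_of_le_ne_top ENNReal.ofReal_ne_top hδ
  calc ∫ x, (exp (φ x) - exp (φ (x.1, -x.2))) ^ 2 / (exp (φ x) + exp (φ (x.1, -x.2))) ∂μT
      ≤ (klDiv (μT.tilted φ) ((μT.tilted φ).map (fun x : PhaseSpace N => (x.1, -x.2)))).toReal :=
        integral_triangular_le_toReal_klDiv μT hinv hφm hi hz1 hfin
    _ ≤ (ENNReal.ofReal (K * δ ^ 2)).toReal := ENNReal.toReal_mono ENNReal.ofReal_ne_top hδ
    _ = K * δ ^ 2 := ENNReal.toReal_ofReal (by positivity)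

/-- **`A2ₚ ∧ SPC ⊢ (K_fix ⟺ ΔSharp)`** (`p > 1`, with A0): modulo the two tail atoms the crux is
EQUIVALENT to the sharp second-order bound in the bounded divergence. [folklore] -/
theorem snapshotKLUpperExpansion_iff_triangular {p : ℝ} (hp : 1 < p) (h0 : NessGibbsReweighting)
    (h2 : NessOddLogRatioMoment p) (hc : NessOddLogRatioConcentration) :
    SnapshotKLUpperExpansion ↔ NessFlipTriangularSharp :=
  ⟨nessFlipTriangularSharp_of_snapshotKLUpperExpansion,
    snapshotKLUpperExpansion_of_triangular hp h0 h2 hc⟩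

end Summit.AtomisticToContinuum.FouriersLaw.Theorems.ExtensiveSnapshotIrreversibility.EnergyWindow

end
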